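import Literature.RepresentationTheory.FiniteGroups.GL2ModularPrincipalSeriesReduction
import Literature.RepresentationTheory.SubrepresentationMapEquiv
import Literature.RepresentationTheory.SubrepresentationResScalars
import HarnessLib

/-!
# The reduction `L₀/ϖL₀` of the integral principal series over the group ring, and the dictionary with the
# subrepresentations of the mod-`ϖ` principal series

Topic `Literature/RepresentationTheory/FiniteGroups`, namespace `Literature.RepresentationTheory.FiniteGroups.GL2`.
DEFINITIONS + API (reviewed kind); no named fact, no instance, no notation, no `sorry`.

Setting [SerreLinearRepresentations1977, §15.1–15.2; EmertonGeeSavitt2015, §4.1]: `R → k` a (surjective) algebra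
onto the residue ring, `ϖ ∈ R` with `ker(R → k) = (ϖ)`, `χ₁ χ₂ : Fˣ → Rˣ`, and the STANDARD stable lattice
`L₀ = Fun_R(Ind_B^{GL₂(F)}(χ₁ ⊗ χ₂))` of the tame principal-series type, whose reduction `L₀/ϖL₀` is the mod-`ϖ`
principal series `Fun_k(Ind(χ̄₁ ⊗ χ̄₂))` (tree: `GL2ModularPrincipalSeriesReduction`).  The lattice lemma
(`Literature.RepresentationTheory.exists_smul_eq_smul_of_socle`, EGS Lemma 4.1.1) speaks about SUBMODULES OVER
THE GROUP RING `R[GL₂(F)]` of `L₀`, of `L₀/ϖL₀` and of its subquotients; the structure theory of the mod-`p`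
principal series (`GL2ModularPrincipalSeriesSocle` / `LengthTwo` / `JordanHolder`) speaks about
`Subrepresentation`s of the `k`-representation.  This file builds the bridge.

MODELS.  Mathlib's `Representation.asModule` of a representation on the function-space carrier `↥(coindV …)`
carries `AddCommMonoid`/`AddCommGroup` instances that do not unify at instance transparency (quotients `M ⧸ N` and
`Submodule.liftQ` fail to elaborate on it), so everything over the group ring is phrased on CLEAN MODELS: on the
`R`-side an arbitrary representation `ρ₀` on an `R`-module `V₀` with an equivalence
`e₀ : ρ₀ ≃ Fun_R(Ind(χ₁ ⊗ χ₂))` (the consumer's own model of the type lattice), on the `k`-side the principal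
series in Bruhat coordinates `coordRep ψ₁ ψ₂` on `Option F → k` (`coordEquiv : 𝓑(ψ₁, ψ₂) ≃ coordRep ψ₁ ψ₂`,
transport along `bruhatEquiv`).

* `coordRep`, `coordEquiv` (+ `_apply`, `_symm_apply`);
* `modelReduce k χ₁ χ₂ e₀ : ρ₀ → coordRep χ̄₁ χ̄₂ |_R` (intertwining), `modelReduceLinear` (over `R[GL₂(F)]`),
  **`ker_modelReduceLinear`** `= ϖ • ⊤`, `modelReduceLinear_surjective`; the same restricted to `⊤`
  (`modelReduceTop`, `ker_modelReduceTop`, `modelReduceTop_surjective`);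
* **`modelReduceQuotEquiv : (⊤ ⧸ ϖ⊤) ≃ₗ[R[GL₂(F)]] (coordRep χ̄₁ χ̄₂ |_R).asModule`** — `L₀/ϖL₀ ≅ 𝓑̄`;
* **`modelSubmoduleOrderIso : Submodule R[GL₂(F)] (L₀/ϖL₀) ≃o Subrepresentation 𝓑(χ̄₁, χ̄₂)`** and the membership
  lemma `mem_modelSubmoduleOrderIso_iff`.
-/

noncomputable section

namespace Literature.RepresentationTheory.FiniteGroups

namespace GL2

open Function Pointwise
open Literature.NumberTheory.Automorphic (TwistedQuotient.resScalars TwistedQuotient.resScalars_apply)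

section CoordModel

variable {F : Type} [Field F] [DecidableEq F] {k : Type*} [CommRing k] (ψ₁ ψ₂ : Fˣ →* kˣ)

/-- **The principal series in Bruhat coordinates**: the representation `Ind_B^{GL₂(F)}(ψ₁ ⊗ ψ₂)` transported to the
coordinate module `Option F → k` along the Bruhat basis isomorphism `bruhatEquiv`. [cite: SerreLinearRepresentations1977, §15.2] -/
def coordRep : Representation k (GL (Fin 2) F) (Option F → k) :=
  (principalSeriesRep F ψ₁ ψ₂).transport (bruhatEquiv ψ₁ ψ₂)

/-- `𝓑(ψ₁, ψ₂) ≃ coordRep ψ₁ ψ₂` as representations (the Bruhat basis isomorphism). [cite: SerreLinearRepresentations1977, §15.2] -/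
def coordEquiv : (principalSeriesRep F ψ₁ ψ₂).Equiv (coordRep ψ₁ ψ₂) :=
  (principalSeriesRep F ψ₁ ψ₂).transportEquiv (bruhatEquiv ψ₁ ψ₂)

/-- Unfolding lemma `coordEquiv_apply`. [cite: SerreLinearRepresentations1977, §15.2] -/
@[simp]
theorem coordEquiv_apply (f : Representation.coindV (borel F).subtype (scalarRep (borelCharacter F ψ₁ ψ₂))) :
    coordEquiv ψ₁ ψ₂ f = bruhatEval ψ₁ ψ₂ f := rfl

/-- Unfolding lemma `coordEquiv_symm_apply`. [cite: SerreLinearRepresentations1977, §15.2] -/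
@[simp]
theorem coordEquiv_symm_apply (φ : Option F → k) : (coordEquiv ψ₁ ψ₂).symm φ = bruhatLift ψ₁ ψ₂ φ := rfl

end CoordModel

section IntegralLattice

variable {F : Type} [Field F] [DecidableEq F] {R : Type} [CommRing R] {k : Type} [CommRing k] [Algebra R k]
  (χ₁ χ₂ : Fˣ →* Rˣ) {V₀ : Type} [AddCommGroup V₀] [Module R V₀] {ρ₀ : Representation R (GL (Fin 2) F) V₀}
  (e₀ : ρ₀.Equiv (principalSeriesRep F χ₁ χ₂))

variable (k) in
/-- The reduction of coefficients read on a model `ρ₀ ≃ Fun_R(Ind(χ₁ ⊗ χ₂))` of the integral principal series and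
in Bruhat coordinates on the `k`-side: `v ↦ (Bruhat coordinates of (R → k) ∘ e₀(v))`, an intertwining map into
the restriction of scalars of `coordRep χ̄₁ χ̄₂`. [cite: SerreLinearRepresentations1977, §15.2] -/
def modelReduce :
    ρ₀.IntertwiningMap (TwistedQuotient.resScalars R (coordRep (reduceChar k χ₁) (reduceChar k χ₂))) :=
  ((coordEquiv (reduceChar k χ₁) (reduceChar k χ₂)).toIntertwiningMap.resScalarsMap R).comp
    ((reduce k χ₁ χ₂).comp e₀.toIntertwiningMap)

/-- Unfolding. [cite: SerreLinearRepresentations1977, §15.2] -/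
theorem modelReduce_apply (v : V₀) :
    modelReduce k χ₁ χ₂ e₀ v = bruhatEval (reduceChar k χ₁) (reduceChar k χ₂) (reduce k χ₁ χ₂ (e₀ v)) := rfl

/-- The reduction as a linear map over the group ring `R[GL₂(F)]`. [cite: SerreLinearRepresentations1977, §15.2] -/
def modelReduceLinear :
    ρ₀.asModule →ₗ[MonoidAlgebra R (GL (Fin 2) F)]
      (TwistedQuotient.resScalars R (coordRep (reduceChar k χ₁) (reduceChar k χ₂))).asModule :=
  Representation.IntertwiningMap.equivLinearMapAsModule _ _ (modelReduce k χ₁ χ₂ e₀)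

/-- Unfolding: `modelReduceLinear` on underlying vectors. [cite: SerreLinearRepresentations1977, §15.2] -/
theorem modelReduceLinear_apply (v : ρ₀.asModule) :
    modelReduceLinear (k := k) χ₁ χ₂ e₀ v =
      (TwistedQuotient.resScalars R (coordRep (reduceChar k χ₁) (reduceChar k χ₂))).asModuleEquiv.symm
        (bruhatEval (reduceChar k χ₁) (reduceChar k χ₂) (reduce k χ₁ χ₂ (e₀ (ρ₀.asModuleEquiv v)))) := rfl

/-- **Kernel of the reduction over the group ring**: `ker = ϖ • ⊤` when `ker(R → k) = (ϖ)`. [cite: SerreLinearRepresentations1977, §15.2] -/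
theorem ker_modelReduceLinear {ϖ : R} (hker : ∀ a : R, algebraMap R k a = 0 ↔ ϖ ∣ a) :
    LinearMap.ker (modelReduceLinear (k := k) χ₁ χ₂ e₀) =
      ϖ • (⊤ : Submodule (MonoidAlgebra R (GL (Fin 2) F)) ρ₀.asModule) := by
  ext v
  rw [LinearMap.mem_ker, ← SetLike.mem_coe, Submodule.coe_pointwise_smul, Set.mem_smul_set,
    modelReduceLinear_apply, LinearEquiv.map_eq_zero_iff, ← bruhatEquiv_apply, LinearEquiv.map_eq_zero_iff,
    reduce_eq_zero_iff χ₁ χ₂ hker]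
  constructor
  · rintro ⟨g, hg⟩
    refine ⟨ρ₀.asModuleEquiv.symm (e₀.symm g), Submodule.mem_top, ?_⟩
    apply ρ₀.asModuleEquiv.injective
    apply e₀.toLinearEquiv.injective
    change e₀ (ρ₀.asModuleEquiv (ϖ • ρ₀.asModuleEquiv.symm (e₀.symm g))) = e₀ (ρ₀.asModuleEquiv v)
    rw [hg, LinearEquiv.map_smul, LinearEquiv.apply_symm_apply, map_smul]
    congr 1
    exact e₀.apply_symm_apply g
  · rintro ⟨y, -, rfl⟩
    exact ⟨e₀ (ρ₀.asModuleEquiv y), by rw [LinearEquiv.map_smul, map_smul]⟩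

/-- The reduction over the group ring is onto when `R → k` is. [cite: SerreLinearRepresentations1977, §15.2] -/
theorem modelReduceLinear_surjective (hsurj : Surjective (algebraMap R k)) :
    Surjective (modelReduceLinear (k := k) χ₁ χ₂ e₀) := by
  intro w
  obtain ⟨f, hf⟩ := reduce_surjective χ₁ χ₂ hsurj (bruhatLift (reduceChar k χ₁) (reduceChar k χ₂)
    ((TwistedQuotient.resScalars R (coordRep (reduceChar k χ₁) (reduceChar k χ₂))).asModuleEquiv w))
  refine ⟨ρ₀.asModuleEquiv.symm (e₀.symm f), ?_⟩
  rw [modelReduceLinear_apply, LinearEquiv.apply_symm_apply, Representation.Equiv.apply_symm_apply, hf,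
    bruhatEval_bruhatLift, LinearEquiv.symm_apply_apply]

/-- The reduction restricted to the top submodule (the standard lattice `L₀` viewed as the submodule `⊤` of its
own model — the shape in which the lattice lemma consumes it). [cite: SerreLinearRepresentations1977, §15.2] -/
def modelReduceTop :
    ↥(⊤ : Submodule (MonoidAlgebra R (GL (Fin 2) F)) ρ₀.asModule) →ₗ[MonoidAlgebra R (GL (Fin 2) F)]
      (TwistedQuotient.resScalars R (coordRep (reduceChar k χ₁) (reduceChar k χ₂))).asModule :=
  (modelReduceLinear χ₁ χ₂ e₀).comp (Submodule.subtype _)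

/-- `ker (reduce|_⊤) = (ϖ • ⊤).comap ⊤.subtype`. [cite: SerreLinearRepresentations1977, §15.2] -/
theorem ker_modelReduceTop {ϖ : R} (hker : ∀ a : R, algebraMap R k a = 0 ↔ ϖ ∣ a) :
    LinearMap.ker (modelReduceTop (k := k) χ₁ χ₂ e₀) =
      (ϖ • (⊤ : Submodule (MonoidAlgebra R (GL (Fin 2) F)) ρ₀.asModule)).comap
        (⊤ : Submodule (MonoidAlgebra R (GL (Fin 2) F)) ρ₀.asModule).subtype := by
  rw [modelReduceTop, LinearMap.ker_comp, ker_modelReduceLinear χ₁ χ₂ e₀ hker]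

/-- `reduce|_⊤` is onto. [cite: SerreLinearRepresentations1977, §15.2] -/
theorem modelReduceTop_surjective (hsurj : Surjective (algebraMap R k)) :
    Surjective (modelReduceTop (k := k) χ₁ χ₂ e₀) := by
  intro w
  obtain ⟨v, hv⟩ := modelReduceLinear_surjective χ₁ χ₂ e₀ hsurj w
  exact ⟨⟨v, Submodule.mem_top⟩, hv⟩

/-- **`L₀ / ϖL₀ ≅ Fun_k(Ind(χ̄₁ ⊗ χ̄₂))` (in Bruhat coordinates) over the group ring** (`ker (R → k) = (ϖ)`,
`R → k` onto): the reduction of the standard lattice IS the mod-`ϖ` principal series. [cite: SerreLinearRepresentations1977, §15.2] -/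
def modelReduceQuotEquiv {ϖ : R} (hker : ∀ a : R, algebraMap R k a = 0 ↔ ϖ ∣ a)
    (hsurj : Surjective (algebraMap R k)) :
    (↥(⊤ : Submodule (MonoidAlgebra R (GL (Fin 2) F)) ρ₀.asModule) ⧸
        (ϖ • (⊤ : Submodule (MonoidAlgebra R (GL (Fin 2) F)) ρ₀.asModule)).comap
          (⊤ : Submodule (MonoidAlgebra R (GL (Fin 2) F)) ρ₀.asModule).subtype)
      ≃ₗ[MonoidAlgebra R (GL (Fin 2) F)]
      (TwistedQuotient.resScalars R (coordRep (reduceChar k χ₁) (reduceChar k χ₂))).asModule :=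
  (Submodule.quotEquivOfEq _ _ (ker_modelReduceTop χ₁ χ₂ e₀ hker).symm).trans
    (LinearMap.quotKerEquivOfSurjective (modelReduceTop (k := k) χ₁ χ₂ e₀)
      (modelReduceTop_surjective χ₁ χ₂ e₀ hsurj))

/-- Unfolding of `modelReduceQuotEquiv` on a class. [cite: SerreLinearRepresentations1977, §15.2] -/
theorem modelReduceQuotEquiv_mk {ϖ : R} (hker : ∀ a : R, algebraMap R k a = 0 ↔ ϖ ∣ a)
    (hsurj : Surjective (algebraMap R k)) (v : ↥(⊤ : Submodule (MonoidAlgebra R (GL (Fin 2) F)) ρ₀.asModule)) :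
    modelReduceQuotEquiv (k := k) χ₁ χ₂ e₀ hker hsurj (Submodule.Quotient.mk v) =
      modelReduceLinear (k := k) χ₁ χ₂ e₀ (v : ρ₀.asModule) := by
  rw [modelReduceQuotEquiv, LinearEquiv.trans_apply, Submodule.quotEquivOfEq_mk,
    LinearMap.quotKerEquivOfSurjective_apply_mk]
  rfl

/-- **The dictionary**: submodules over the group ring of `L₀/ϖL₀` ↔ subrepresentations of the mod-`ϖ` principal
series `Fun_k(Ind(χ̄₁ ⊗ χ̄₂))` (an order isomorphism). [cite: SerreLinearRepresentations1977, §15.2] -/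
def modelSubmoduleOrderIso {ϖ : R} (hker : ∀ a : R, algebraMap R k a = 0 ↔ ϖ ∣ a)
    (hsurj : Surjective (algebraMap R k)) :
    Submodule (MonoidAlgebra R (GL (Fin 2) F))
        (↥(⊤ : Submodule (MonoidAlgebra R (GL (Fin 2) F)) ρ₀.asModule) ⧸
          (ϖ • (⊤ : Submodule (MonoidAlgebra R (GL (Fin 2) F)) ρ₀.asModule)).comap
            (⊤ : Submodule (MonoidAlgebra R (GL (Fin 2) F)) ρ₀.asModule).subtype)
      ≃o Subrepresentation (principalSeriesRep F (reduceChar k χ₁) (reduceChar k χ₂)) :=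
  (Submodule.orderIsoMapComap (modelReduceQuotEquiv χ₁ χ₂ e₀ hker hsurj)).trans
    ((Subrepresentation.subrepresentationSubmoduleOrderIso).symm.trans
      ((subrepResScalarsOrderIso (coordRep (reduceChar k χ₁) (reduceChar k χ₂)) hsurj).trans
        (Subrepresentation.mapEquiv (coordEquiv (reduceChar k χ₁) (reduceChar k χ₂))).symm))

/-- Membership in the dictionary image: `w ∈ Φ N` iff the Bruhat coordinates of `w` are the reduction of a class
`q ∈ N`. [cite: SerreLinearRepresentations1977, §15.2] -/
theorem mem_modelSubmoduleOrderIso_iff {ϖ : R} (hker : ∀ a : R, algebraMap R k a = 0 ↔ ϖ ∣ a)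
    (hsurj : Surjective (algebraMap R k))
    (N : Submodule (MonoidAlgebra R (GL (Fin 2) F))
        (↥(⊤ : Submodule (MonoidAlgebra R (GL (Fin 2) F)) ρ₀.asModule) ⧸
          (ϖ • (⊤ : Submodule (MonoidAlgebra R (GL (Fin 2) F)) ρ₀.asModule)).comap
            (⊤ : Submodule (MonoidAlgebra R (GL (Fin 2) F)) ρ₀.asModule).subtype))
    (w : Representation.coindV (borel F).subtype
        (scalarRep (borelCharacter F (reduceChar k χ₁) (reduceChar k χ₂)))) :
    w ∈ modelSubmoduleOrderIso (k := k) χ₁ χ₂ e₀ hker hsurj N ↔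
      ∃ q ∈ N, modelReduceQuotEquiv (k := k) χ₁ χ₂ e₀ hker hsurj q =
        (TwistedQuotient.resScalars R (coordRep (reduceChar k χ₁) (reduceChar k χ₂))).asModuleEquiv.symm
          (bruhatEval (reduceChar k χ₁) (reduceChar k χ₂) w) := by
  change bruhatEval (reduceChar k χ₁) (reduceChar k χ₂) w ∈ Subrepresentation.ofSubmodule'
      (Submodule.orderIsoMapComap (modelReduceQuotEquiv χ₁ χ₂ e₀ hker hsurj) N) ↔ _
  rw [Subrepresentation.mem_ofSubmodule'_iff, Submodule.orderIsoMapComap_apply]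
  exact Submodule.mem_map
    (x := (TwistedQuotient.resScalars R (coordRep (reduceChar k χ₁) (reduceChar k χ₂))).asModuleEquiv.symm
      (bruhatEval (reduceChar k χ₁) (reduceChar k χ₂) w))

end IntegralLattice

end GL2

end Literature.RepresentationTheory.FiniteGroups
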